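import Summits.CriticalPhenomena.PercolationContinuityZ3.Theorems.PercNearOneGluingNoHeavyLowerTailOneCutSymmMoves
import HarnessLib

/-!
# `NoHeavyLowerTail` (stmt-CriticalPhenomena-4575) — observer transfer across a cut vertex

Support file for the crux `Summit.CriticalPhenomena.PercolationContinuityZ3.Theses.PercNearOneGluing.NoHeavyLowerTail`,
line `one-cut-symmetrisation` (route task nh7-symmetrise).  No definitions, no named facts, no sorries.

`…OneCutSymmMoves.lean` proves the root-thinning move `OneCutSymm.lowerTail_observerTransfer` under the
almost-sure hypothesis `o ↔ a ⇒ o ↔ h` for every relay `a`.  This file derives that hypothesis from GRAPH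
data: if `o` lies in a vertex set `S` containing no relay and every edge from `S` to a vertex outside `S`
other than `h` has weight `0` (so `h` is a cut vertex between `o` and `A` in the support graph when `h ∉ S`),
then the hypothesis holds (`observer_sep_of_cutVertex`) and hence
`μ B_ρ(o) ≤ μ B_ρ(h)` (`lowerTail_observerTransfer_of_cutVertex`).  Consequence for the compression scheme:
WLOG no single vertex separates the observer from the relay set (in particular a non-relay observer hanging
off the graph by a path may be replaced by the path's attachment point).
-/

noncomputable section

namespace Summit.CriticalPhenomena.PercolationContinuityZ3.Theorems

open MeasureTheory Set Literature.Probability.LatticeModels Literature.Probability.Percolation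
open scoped Classical BigOperators

namespace OneCutSymm

variable {n : ℕ}

/-- **A cut vertex in the support graph separates almost surely.**  If `o ∈ S`, `a ∉ S` and every edge
`s(u, v)` with `u ∈ S`, `v ∉ S`, `v ≠ h` has weight `0`, then `μ(o ↔ a, o ↮ h) = 0`: almost surely no such
edge is open, and an open walk from `o` to `a` must leave `S`, necessarily by an edge into `h`.  (Typically
`h ∉ S`, i.e. `h` is a cut vertex between `o` and `a` in the support graph; the lemma does not need it.)
[folklore] -/
theorem observer_sep_of_cutVertex (w : Sym2 (Fin n) → unitInterval) (S : Finset (Fin n)) (o h a : Fin n)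
    (ho : o ∈ S) (ha : a ∉ S)
    (hcut : ∀ u ∈ S, ∀ v ∉ S, v ≠ h → w s(u, v) = 0) :
    (prodBernoulli w).real (openConn o a ∩ (openConn o h)ᶜ) = 0 := by
  classical
  set μ := prodBernoulli w with hμ
  -- the null event: some boundary edge avoiding `h` is open
  set Z := ⋃ u ∈ S, ⋃ v ∈ (Finset.univ \ S).erase h,
      ({ω | s(u, v) ∈ ω} : Set (BondConfig (Fin n))) with hZ
  have hZ0 : μ.real Z = 0 := by
    apply le_antisymm _ measureReal_nonneg
    calc μ.real Z ≤ ∑ u ∈ S, μ.real (⋃ v ∈ (Finset.univ \ S).erase h,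
            ({ω | s(u, v) ∈ ω} : Set (BondConfig (Fin n)))) := measureReal_biUnion_finset_le _ _
      _ ≤ ∑ u ∈ S, ∑ v ∈ (Finset.univ \ S).erase h,
            μ.real ({ω | s(u, v) ∈ ω} : Set (BondConfig (Fin n))) :=
          Finset.sum_le_sum fun u _ => measureReal_biUnion_finset_le _ _
      _ = 0 := Finset.sum_eq_zero fun u hu => Finset.sum_eq_zero fun v hv => by
          obtain ⟨hvh, hv'⟩ := Finset.mem_erase.1 hv
          have hvS : v ∉ S := (Finset.mem_sdiff.1 hv').2
          rw [hμ, prodBernoulli_real_setOf_mem, hcut u hu v hvS hvh]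
          rfl
  apply le_antisymm _ measureReal_nonneg
  calc μ.real (openConn o a ∩ (openConn o h)ᶜ) ≤ μ.real Z :=
        measureReal_mono (fun ω hω => ?_) (measure_ne_top _ _)
    _ = 0 := hZ0
  -- off `Z`, an open walk from `o` to `a` passes through `h`
  obtain ⟨hoa, hnoh⟩ := hω
  by_contra hωZ
  apply hnoh
  obtain ⟨p⟩ := (show (openGraph ω).Reachable o a from hoa)
  obtain ⟨d, hd, hdS, hdnS⟩ := p.exists_boundary_dart (↑S : Set (Fin n)) (by exact_mod_cast ho)
    (by exact_mod_cast ha)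
  have hadj := d.adj
  rw [openGraph_adj] at hadj
  have hdS' : d.fst ∈ S := by exact_mod_cast hdS
  have hdnS' : d.snd ∉ S := by exact_mod_cast hdnS
  have hsnd : d.snd = h := by
    by_contra hne
    exact hωZ (Set.mem_biUnion hdS' (Set.mem_biUnion (Finset.mem_erase.2 ⟨hne,
      Finset.mem_sdiff.2 ⟨Finset.mem_univ _, hdnS'⟩⟩) hadj.1))
  have hmem : h ∈ p.support := hsnd ▸ p.dart_snd_mem_support_of_mem_darts hd
  exact ⟨p.takeUntil h hmem⟩

/-- **Observer transfer across a cut vertex.**  If `o ∈ S`, no relay lies in `S`, and every edge from `S`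
to a vertex outside `S` other than `h` has weight `0`, then for every ratio `ρ ≥ 0` the lower-tail
mass seen from `o` is at most the one seen from `h` (and the pairwise cuts are the same). [folklore] -/
theorem lowerTail_observerTransfer_of_cutVertex (w : Sym2 (Fin n) → unitInterval) (A S : Finset (Fin n))
    (o h : Fin n) (ρ : ℝ) (hρ : 0 ≤ ρ) (ho : o ∈ S) (hA : ∀ a ∈ A, a ∉ S)
    (hcut : ∀ u ∈ S, ∀ v ∉ S, v ≠ h → w s(u, v) = 0) :
    (prodBernoulli w).real {ω : BondConfig (Fin n) |
        1 ≤ (A.filter fun a => ω ∈ openConn o a).card ∧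
        ((A.filter fun a => ω ∈ openConn o a).card : ℝ) <
          ρ * ∑ a ∈ A, (prodBernoulli w).real (openConn o a)} ≤
    (prodBernoulli w).real {ω : BondConfig (Fin n) |
        1 ≤ (A.filter fun a => ω ∈ openConn h a).card ∧
        ((A.filter fun a => ω ∈ openConn h a).card : ℝ) <
          ρ * ∑ a ∈ A, (prodBernoulli w).real (openConn h a)} :=
  lowerTail_observerTransfer w A o h ρ hρ fun a ha =>
    observer_sep_of_cutVertex w S o h a ho (hA a ha) hcut

end OneCutSymm

end Summit.CriticalPhenomena.PercolationContinuityZ3.Theorems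

end
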